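import Summits.QuantumFields.BalabanUV.T4Continuum.Support.NE9PolydiscSchwarzPick
import Literature.MathematicalPhysics.QuantumFieldTheory.Balaban1983to89.T4HistoryLipschitzActivity
import Literature.Analysis.Complex.GateauxHolomorphicBall

/-!
# NE9TablePolydiscSP — ROUTE R3′♯-SP, PART 1 (the ENGINE): Schwarz–Pick on the TABLE POLYDISC `ℓ^∞(A;ℂ)` — a bounded holomorphic scalar
# function on the ball `‖Q‖ < R₀` is `M·R₀∕(R₀² − s₀²)`-Lipschitz on `‖Q‖ ≤ s₀` (Cauchy on the stadium of the pencil's LINE: `M∕(R₀ − s₀)`;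
# ratio `R₀∕(R₀ + s₀)`), and the one-step pinned cluster-sum bound of route R3′ (E128 §D `norm_clusterSum_sub_le_of_ballKPG_sharp`, same
# binders at `Pot := ℓ^∞(A;ℂ)`) at the constant `a(γ)e^{−δ}·R₀∕(R₀² − s₀²)`.  PART 2 `NE9TablePolydiscSPEnd` re-threads E129's record-shape END.

Cell `pub-balaban`, T4-DAG §6 row NE9; NE9 crux team (coordinator ruling «YM REDIRECT» e34b3e0c (2)), leaf lineage
`b2b-balaban-t4-ne9-formalise-leaf-06` generation 40; route R3′ «pencil ∕ potential-KPG» of `t4/ROUTES-NE9.md` v8.0.1 §L1.3 ADDENDUM «R3′♯-SP»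
(co-lead, rank 2 of record).  ENGINE AND AUTHORSHIP OF THE LEAN BELOW: the crux-ideation seat `b2b-balaban-t4-ne9-idea-1` generation 8 (lens 1 =
analytic dependence ∕ implicit-function ∕ fixed-point operators), HOME scratch `t4/ideate/NE9/lens1-NE9TablePolydiscSP.lean` sha16 1bacbd220ebeef05
(215 l.; kernel-checked rc 0 ∣ 0 ∣ 0, axioms {propext, Classical.choice, Quot.sound} by its author, by the pricing desk `t4-ne9-refuter` g10
(PRICING-NE9 v10 §B «F-v10-1: CORRECT, SHARP for its data class, same instance list + `0 ≤ s₀`») and by this seat) — reproduced VERBATIM under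
the tree namespace (only the namespace, the split into two ≤ 400-l. files and the headers differ; docstrings kept), FILED by leaf-06 as the
refuter's open item **O-v8-SP** («dock ≈ 150 l. — owner or leaf-06 or nobody; T19 lettered for both») after the row OWNER `t4-ne9-p1` g61
DECLINED it for his lineage («R3′-side constant work; leaf-06∕idea-1's if anyone's», journal l.29955) and idea-1 g8 deferred («the OWNER's ∕
leaf-06's call, not mine», l.29577); journal INTENT 1 l.29979.

THE MECHANISM (idea-1 §L1.3; refuter §B(B10-1)).  E128 §C's scalarised generating function of ONE pinned cluster sum is run as a function of
the TABLE `Q ∈ ℓ^∞(A;ℂ)`: each activity is Gâteaux-holomorphic (`LineHolo`) and bounded by its majorant on the ball `‖Q‖ < R₀`, hence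
Fréchet-holomorphic (`Literature.Analysis.Complex.GateauxHolomorphicBall.differentiableOn_of_gateaux_of_bounded`); KP at every point of the ball
gives zero-freeness (`differentiableOn_polymerLogZ_param` over the parameter space `ℓ^∞(A;ℂ)`) and the bound `a(γ)`; then route R4♯'s kernel M1
`NE9PolydiscSchwarzPick.norm_fderiv_apply_le` (leaf-03, p255292; here with `π = id` on `ℂ`) — the infinitesimal polydisc Schwarz–Pick bound —
integrated along the segment inside the closed `s₀`-polydisc (mean value inequality) gives the Lipschitz constant `M·R₀∕(R₀² − s₀²)` in place of
Cauchy's `M∕(R₀ − s₀)` on the stadium.  GAIN = the PRODUCT structure of the `ℓ^∞` table ball (the far side of EVERY coordinate disc), which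
no line-restricted estimate sees; SHARP for the data class {`g` holomorphic on the `R₀`-polydisc, `|g| ≤ M`, tables in the closed `s₀`-polydisc}
(a coordinate Möbius map realises it; refuter P-R3-8).  A sharper constant inside a CONDITIONAL END is NOT progress on the estimate NE9 itself.

HONEST FRAMING (T4-DAG PAGE 1).  Rung (B)+1 of the FINITE-VOLUME T⁴ programme — NOT infinite volume, NOT a mass gap, NOT the Clay problem.  NE9
(`T4OutputRate.NE9` ∧ `FadingMemory`) is a cell NEW ESTIMATE, NOT PRINTED in [I] = [Balaban1987RG1] (CMP **109**), [II] = [Balaban1988RG2Cluster]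
(CMP **116**), NOT PROVED for Bałaban's E^{(j)}: every END of the route is «NE9 ⇐ the named binders» (potential-KPG = line-holomorphy + majorant on
the table ball `‖Q‖ < R₀` AT EVERY BACKGROUND incl. `U₀` = the (R-0)[scope] clause, typed as `NE9PencilScope238` (E133 p258881), + KP for `m`;
`hdec`, `hpin`, `hocc` or the size block, the reading law, the structural binders, and the COUPLING HALF `hlast` — whose own suppliers keep
`TwoPointKP` (KP for `2n`) ∕ `hCup` ∕ `hTcup` — all DISPLAYED); W1 = the model O-NE9-1 untouched (PARKED under FREEZE (0)); the displays `z`, `S`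
are ε₁-dials of an instancer that does not exist; row NE9 WALLED ON A MODEL; spine PROVED 0∕9.  HONEST DEPENDENCY (cell line, verbatim):
continuum YM on T⁴ ⇐ BetaPertH ∧ nine spine estimates (0/9 proved); BetaPertH ⇐ (D1) ∧ (D4) ∧ CAP+tail; G-an2-4 gates asym, D1 and NE2/3/4.
`FlowStep.BetaPertH`, (B), (B^μ) do not occur; [I]∕[II] for TYPES only (ABSOLUTE RULE).

CONTENT ([folklore]; 0 def, 0 Prop-valued definition, 0 sorry):
* §1 `norm_sub_le_of_polydiscSP_unit_aux` (auxiliary `θ' ∈ (θ,1]`) ∕ `norm_sub_le_of_polydiscSP_unit` (unit ball, sharp `θ∕(1 − σ²)`) ∕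
  **`norm_sub_le_of_polydiscSP`** (radius `R₀` by dilation: `‖f Q − f Q′‖ ≤ M·R₀∕(R₀² − s₀²)·‖Q − Q′‖` on `‖Q‖, ‖Q′‖ ≤ s₀ < R₀`).
* §2 **`norm_clusterSum_sub_le_of_ballKPG_SP`** — E128 §D's binder list VERBATIM at `Pot := ℓ^∞(A;ℂ)` ⊢ `‖E_{w(Q)}(𝒞) − E_{w(Q′)}(𝒞)‖ ≤
  a(γ)e^{−δ}·R₀∕(R₀² − s₀²)·‖Q − Q′‖`; `spConstant_eq_stadium_mul_ratio` (`M·R₀∕(R₀² − s₀²) = (M∕(R₀ − s₀))·(R₀∕(R₀ + s₀))`).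
DISGUISE TEST: complex analysis on `ℓ^∞` over the tree's own KP ∕ cluster-expansion lemmas; nothing of Bałaban's asserted; no named fact; no
activity, species or estimate of the series touched; E128 is PARALLELED by name at one `Pot`, not modified.

References (TYPES ∕ loci only): [Balaban1987RG1] T. Bałaban, CMP **109** (1987) 249–301 — (0.23) p. 256, (2.13)–(2.14) p. 268;
[Balaban1988RG2Cluster] T. Bałaban, CMP **116** (1988) 1–22 — (1.36) p. 9, Lemma 3 (2.38) p. 20, (2.40)–(2.41) p. 21; [KoteckyPreiss1986]
CMP **103** (1986) 491–498, p. 492–493; [FV1980] T. Franzoni, E. Vesentini, *Holomorphic Maps and Invariant Distances*, North-Holland Math.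
Studies 40 (1980), ch. V §5 (polydisc Schwarz–Pick); [Harris1979] L. A. Harris, North-Holland Math. Studies 34 (1979) 345–406.
Summits-side NEW work (LEAN PLACEMENT RULE); imports `NE9PolydiscSchwarzPick` (leaf-03) and Literature `T4HistoryLipschitzActivity` ∕
`GateauxHolomorphicBall` BY NAME; modifies nothing; 0 sorry.  Value = the table-half engine of route R3′♯-SP in the tree (refuter O-v8-SP, T19),
NOT summit progress.
-/

noncomputable section

namespace Summit.QuantumFields.BalabanUV.T4Continuum.NE9TablePolydiscSP

open Metric Set Filter
open scoped Topology BigOperators ComplexConjugate ENNReal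
open Summit.QuantumFields.BalabanUV.T4Continuum.NE9PolydiscSchwarzPick (norm_coordFn_le norm_fderiv_apply_le)
open Literature.Probability.LatticeModels
open Literature.MathematicalPhysics.QuantumFieldTheory.Balaban1983to89
open Literature.MathematicalPhysics.QuantumFieldTheory.Balaban1983to89.T4OutputRate
open Literature.MathematicalPhysics.QuantumFieldTheory.Balaban1983to89.T4ActivityLipschitz
open Literature.MathematicalPhysics.QuantumFieldTheory.Balaban1983to89.T4HistoryLipschitzRecursion
open Literature.MathematicalPhysics.QuantumFieldTheory.Balaban1983to89.T4HistoryLipschitzOuter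
open Literature.MathematicalPhysics.QuantumFieldTheory.Balaban1983to89.T4HistoryLipschitzActivity
open Literature.MathematicalPhysics.QuantumFieldTheory.Balaban1983to89.T4HistoryLipschitzActivity (ClusterGeom)
open Literature.Analysis.Complex.GateauxHolomorphic (differentiableOn_of_gateaux_of_bounded)

variable {A : Type*}

/-! ## §1 Schwarz–Pick Lipschitz bound for a bounded holomorphic SCALAR function on the polydisc -/

section SP

/-- Unit ball, auxiliary parameter `θ' ∈ (θ,1]`: `f : ℓ^∞(A;ℂ) → ℂ` holomorphic on `B(0,1)` with values in `B̄(0,θ)` is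
`θ'∕(1 − σ²)`-Lipschitz on `B̄(0,σ)`, `σ < 1` (M1's polydisc Schwarz–Pick derivative bound with `π = id` + mean value).
[folklore; FV1980 ch. V §5] -/
theorem norm_sub_le_of_polydiscSP_unit_aux {θ θ' σ : ℝ} (hθ0 : 0 ≤ θ) (hθθ' : θ < θ') (hθ'1 : θ' ≤ 1)
    (hσ1 : σ < 1) {f : lp (fun _ : A => ℂ) ∞ → ℂ} (hfd : DifferentiableOn ℂ f (ball (0 : lp (fun _ : A => ℂ) ∞) 1))
    (hfm : MapsTo f (ball (0 : lp (fun _ : A => ℂ) ∞) 1) (closedBall 0 θ))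
    {x y : lp (fun _ : A => ℂ) ∞} (hx : x ∈ closedBall (0 : lp (fun _ : A => ℂ) ∞) σ)
    (hy : y ∈ closedBall (0 : lp (fun _ : A => ℂ) ∞) σ) :
    ‖f x - f y‖ ≤ θ' / (1 - σ ^ 2) * ‖x - y‖ := by
  have hθ'0 : 0 < θ' := lt_of_le_of_lt hθ0 hθθ'
  have hσ0 : -1 < σ := by
    have := mem_closedBall_zero_iff.1 hx
    linarith [norm_nonneg x]
  have h1σ : 0 < 1 - σ ^ 2 := by
    rw [show (1 : ℝ) - σ ^ 2 = (1 - σ) * (1 + σ) by ring]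
    exact mul_pos (sub_pos.mpr hσ1) (by linarith)
  have hsub : closedBall (0 : lp (fun _ : A => ℂ) ∞) σ ⊆ ball 0 1 := closedBall_subset_ball hσ1
  -- (a) derivative + the polydisc Schwarz–Pick bound at every point of the inner ball
  have hder : ∀ z ∈ closedBall (0 : lp (fun _ : A => ℂ) ∞) σ,
      HasFDerivAt f (fderiv ℂ f z) z ∧
        ∀ w : lp (fun _ : A => ℂ) ∞, ‖fderiv ℂ f z w‖ ≤ θ' * (‖w‖ / (1 - σ ^ 2)) := by
    intro z hz
    have hz1 : z ∈ ball (0 : lp (fun _ : A => ℂ) ∞) 1 := hsub hz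
    have hzσ : ‖z‖ ≤ σ := mem_closedBall_zero_iff.1 hz
    refine ⟨(hfd.differentiableAt (isOpen_ball.mem_nhds hz1)).hasFDerivAt, fun w => ?_⟩
    have hC : 0 ≤ ‖w‖ / (1 - σ ^ 2) := div_nonneg (norm_nonneg w) h1σ.le
    have hv : ∀ α, ‖w α‖ ≤ ‖w‖ / (1 - σ ^ 2) * (1 - ‖z α‖ ^ 2) := fun α => by
      have hzα : ‖z α‖ ≤ σ := (norm_coordFn_le z α).trans hzσ
      have h1 : 1 - σ ^ 2 ≤ 1 - ‖z α‖ ^ 2 := by nlinarith [norm_nonneg (z α)]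
      calc ‖w α‖ ≤ ‖w‖ := norm_coordFn_le w α
        _ = ‖w‖ / (1 - σ ^ 2) * (1 - σ ^ 2) := (div_mul_cancel₀ _ h1σ.ne').symm
        _ ≤ ‖w‖ / (1 - σ ^ 2) * (1 - ‖z α‖ ^ 2) := mul_le_mul_of_nonneg_left h1 hC
    have key := norm_fderiv_apply_le (ContinuousLinearMap.id ℂ ℂ) (fun u => by simp) hθ0 hθθ' hθ'1 hfd hfm hz1 w hC hv
    simp only [ContinuousLinearMap.coe_id', id_eq] at key
    have h1 : 1 - ‖f z‖ ^ 2 ≤ 1 := by nlinarith [norm_nonneg (f z)]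
    have hCw : 0 ≤ θ' * (‖w‖ / (1 - σ ^ 2)) := mul_nonneg hθ'0.le hC
    calc ‖fderiv ℂ f z w‖ ≤ θ' * (‖w‖ / (1 - σ ^ 2)) * (1 - ‖f z‖ ^ 2) := key
      _ ≤ θ' * (‖w‖ / (1 - σ ^ 2)) * 1 := mul_le_mul_of_nonneg_left h1 hCw
      _ = θ' * (‖w‖ / (1 - σ ^ 2)) := mul_one _
  -- (b) operator norm of the derivative on the inner ball
  have hop : ∀ z ∈ closedBall (0 : lp (fun _ : A => ℂ) ∞) σ, ‖fderiv ℂ f z‖ ≤ θ' / (1 - σ ^ 2) := by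
    intro z hz
    refine ContinuousLinearMap.opNorm_le_bound _ (div_nonneg hθ'0.le h1σ.le) fun w => ?_
    calc ‖fderiv ℂ f z w‖ ≤ θ' * (‖w‖ / (1 - σ ^ 2)) := (hder z hz).2 w
      _ = θ' / (1 - σ ^ 2) * ‖w‖ := by ring
  -- (c) mean value on the convex inner ball
  exact (convex_closedBall (0 : lp (fun _ : A => ℂ) ∞) σ).norm_image_sub_le_of_norm_hasFDerivWithin_le
    (f := f) (f' := fun z => fderiv ℂ f z) (fun z hz => (hder z hz).1.hasFDerivWithinAt) hop hy hx

/-- Unit ball, SHARP: `f : ℓ^∞(A;ℂ) → ℂ` holomorphic on `B(0,1)` with values in `B̄(0,θ)`, `θ < 1`, is `θ∕(1 − σ²)`-Lipschitz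
on `B̄(0,σ)` (`θ' ↓ θ`). [folklore; FV1980 ch. V §5] -/
theorem norm_sub_le_of_polydiscSP_unit {θ σ : ℝ} (hθ0 : 0 ≤ θ) (hθ1 : θ < 1) (hσ1 : σ < 1)
    {f : lp (fun _ : A => ℂ) ∞ → ℂ} (hfd : DifferentiableOn ℂ f (ball (0 : lp (fun _ : A => ℂ) ∞) 1))
    (hfm : MapsTo f (ball (0 : lp (fun _ : A => ℂ) ∞) 1) (closedBall 0 θ))
    {x y : lp (fun _ : A => ℂ) ∞} (hx : x ∈ closedBall (0 : lp (fun _ : A => ℂ) ∞) σ)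
    (hy : y ∈ closedBall (0 : lp (fun _ : A => ℂ) ∞) σ) :
    ‖f x - f y‖ ≤ θ / (1 - σ ^ 2) * ‖x - y‖ := by
  have h : ∀ θ', θ < θ' → θ' ≤ 1 → ‖f x - f y‖ ≤ θ' / (1 - σ ^ 2) * ‖x - y‖ :=
    fun θ' h1 h2 => norm_sub_le_of_polydiscSP_unit_aux hθ0 h1 h2 hσ1 hfd hfm hx hy
  have hcont : Tendsto (fun θ' : ℝ => θ' / (1 - σ ^ 2) * ‖x - y‖) (𝓝[>] θ)
      (𝓝 (θ / (1 - σ ^ 2) * ‖x - y‖)) :=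
    (((continuous_id.div_const (1 - σ ^ 2)).mul continuous_const).tendsto θ).mono_left nhdsWithin_le_nhds
  have hev : ∀ᶠ θ' in 𝓝[>] θ, ‖f x - f y‖ ≤ θ' / (1 - σ ^ 2) * ‖x - y‖ := by
    filter_upwards [Ioo_mem_nhdsGT hθ1] with θ' hθ' using h θ' hθ'.1 hθ'.2.le
  exact ge_of_tendsto hcont hev

/-- **SCHWARZ–PICK LIPSCHITZ BOUND ON THE TABLE POLYDISC**: `f : ℓ^∞(A;ℂ) → ℂ` holomorphic on the ball `‖Q‖ < R₀` with
`‖f‖ ≤ M` there is `M·R₀∕(R₀² − s₀²)`-Lipschitz on `‖Q‖ ≤ s₀ < R₀` (Cauchy∕stadium: `M∕(R₀ − s₀)`; ratio `R₀∕(R₀ + s₀)`).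
By dilation from the unit-ball lemma. [folklore; FV1980 ch. V §5] -/
theorem norm_sub_le_of_polydiscSP {f : lp (fun _ : A => ℂ) ∞ → ℂ} {M R₀ s₀ : ℝ} (hsR : s₀ < R₀)
    (hf : DifferentiableOn ℂ f (ball (0 : lp (fun _ : A => ℂ) ∞) R₀))
    (hM : ∀ Q ∈ ball (0 : lp (fun _ : A => ℂ) ∞) R₀, ‖f Q‖ ≤ M)
    {Q Q' : lp (fun _ : A => ℂ) ∞} (hQ : ‖Q‖ ≤ s₀) (hQ' : ‖Q'‖ ≤ s₀) :
    ‖f Q - f Q'‖ ≤ M * R₀ / (R₀ ^ 2 - s₀ ^ 2) * ‖Q - Q'‖ := by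
  have hs : 0 ≤ s₀ := (norm_nonneg Q).trans hQ
  have hR : 0 < R₀ := lt_of_le_of_lt hs hsR
  have hM0 : 0 ≤ M := (norm_nonneg (f 0)).trans (hM 0 (mem_ball_self hR))
  have hσ1 : s₀ / R₀ < 1 := (div_lt_one hR).2 hsR
  have hM1 : 0 < M + 1 := by linarith
  have hθ0 : 0 ≤ M / (M + 1) := div_nonneg hM0 hM1.le
  have hθ1 : M / (M + 1) < 1 := (div_lt_one hM1).2 (by linarith)
  have hR0 : (R₀ : ℂ) ≠ 0 := Complex.ofReal_ne_zero.2 hR.ne'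
  have hnr : ∀ z : lp (fun _ : A => ℂ) ∞, ‖(R₀ : ℂ) • z‖ = R₀ * ‖z‖ := fun z => by
    rw [norm_smul, Complex.norm_of_nonneg hR.le]
  have hnr' : ∀ z : lp (fun _ : A => ℂ) ∞, ‖(R₀ : ℂ)⁻¹ • z‖ = R₀⁻¹ * ‖z‖ := fun z => by
    rw [norm_smul, norm_inv, Complex.norm_of_nonneg hR.le]
  have hnM : ∀ u : ℂ, ‖((M + 1 : ℝ) : ℂ)⁻¹ • u‖ = (M + 1)⁻¹ * ‖u‖ := fun u => by
    rw [norm_smul, norm_inv, Complex.norm_of_nonneg hM1.le]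
  -- the rescaled function on the unit ball
  set g : lp (fun _ : A => ℂ) ∞ → ℂ := fun z => ((M + 1 : ℝ) : ℂ)⁻¹ • f ((R₀ : ℂ) • z) with hg
  have hball : MapsTo (fun z : lp (fun _ : A => ℂ) ∞ => (R₀ : ℂ) • z) (ball 0 1) (ball 0 R₀) := by
    intro z hz
    rw [mem_ball_zero_iff] at hz ⊢
    rw [hnr]; nlinarith
  have hgd : DifferentiableOn ℂ g (ball (0 : lp (fun _ : A => ℂ) ∞) 1) :=
    (hf.comp ((differentiable_id.const_smul (R₀ : ℂ)).differentiableOn) hball).const_smul (((M + 1 : ℝ) : ℂ)⁻¹)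
  have hgm : MapsTo g (ball (0 : lp (fun _ : A => ℂ) ∞) 1) (closedBall 0 (M / (M + 1))) := by
    intro z hz
    have h := hM _ (hball hz)
    rw [mem_closedBall_zero_iff]
    show ‖((M + 1 : ℝ) : ℂ)⁻¹ • f ((R₀ : ℂ) • z)‖ ≤ M / (M + 1)
    rw [hnM]
    calc (M + 1)⁻¹ * ‖f ((R₀ : ℂ) • z)‖ ≤ (M + 1)⁻¹ * M := mul_le_mul_of_nonneg_left h (inv_nonneg.2 hM1.le)
      _ = M / (M + 1) := by rw [inv_mul_eq_div]
  have hin : ∀ z : lp (fun _ : A => ℂ) ∞, ‖z‖ ≤ s₀ →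
      (R₀ : ℂ)⁻¹ • z ∈ closedBall (0 : lp (fun _ : A => ℂ) ∞) (s₀ / R₀) := by
    intro z hz
    rw [mem_closedBall_zero_iff, hnr']
    calc R₀⁻¹ * ‖z‖ ≤ R₀⁻¹ * s₀ := mul_le_mul_of_nonneg_left hz (inv_nonneg.2 hR.le)
      _ = s₀ / R₀ := by rw [inv_mul_eq_div]
  have key := norm_sub_le_of_polydiscSP_unit hθ0 hθ1 hσ1 hgd hgm (hin Q hQ) (hin Q' hQ')
  -- unscale
  have h1 : g ((R₀ : ℂ)⁻¹ • Q) - g ((R₀ : ℂ)⁻¹ • Q') = ((M + 1 : ℝ) : ℂ)⁻¹ • (f Q - f Q') := by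
    show ((M + 1 : ℝ) : ℂ)⁻¹ • f ((R₀ : ℂ) • ((R₀ : ℂ)⁻¹ • Q)) -
        ((M + 1 : ℝ) : ℂ)⁻¹ • f ((R₀ : ℂ) • ((R₀ : ℂ)⁻¹ • Q')) = _
    rw [smul_smul, mul_inv_cancel₀ hR0, one_smul, smul_smul, mul_inv_cancel₀ hR0, one_smul, smul_sub]
  have h2 : (R₀ : ℂ)⁻¹ • Q - (R₀ : ℂ)⁻¹ • Q' = (R₀ : ℂ)⁻¹ • (Q - Q') := (smul_sub _ _ _).symm
  rw [h1, h2, hnr', hnM] at key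
  have hRne : R₀ ≠ 0 := hR.ne'
  have hM1ne : M + 1 ≠ 0 := hM1.ne'
  have hD : 0 < R₀ ^ 2 - s₀ ^ 2 := by
    rw [show R₀ ^ 2 - s₀ ^ 2 = (R₀ - s₀) * (R₀ + s₀) by ring]
    exact mul_pos (sub_pos.mpr hsR) (by linarith)
  have hDne : R₀ ^ 2 - s₀ ^ 2 ≠ 0 := hD.ne'
  have hσ2 : 1 - (s₀ / R₀) ^ 2 = (R₀ ^ 2 - s₀ ^ 2) / R₀ ^ 2 := by
    field_simp
  have heq : M / (M + 1) / (1 - (s₀ / R₀) ^ 2) * (R₀⁻¹ * ‖Q - Q'‖) =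
      (M + 1)⁻¹ * (M * R₀ / (R₀ ^ 2 - s₀ ^ 2) * ‖Q - Q'‖) := by
    rw [hσ2]
    field_simp
  rw [heq] at key
  exact le_of_mul_le_mul_left key (inv_pos.2 hM1)

end SP

/-! ## §2 The one-step cluster-sum bound on the table polydisc: constant `a(γ)e^{−δ}·R₀∕(R₀² − s₀²)` -/

section ClusterSum

variable {P : Type*} [DecidableEq P] {inc : P → P → Prop} [DecidableRel inc]

/-- **`norm_clusterSum_sub_le_of_ballKPG_sharp` ON THE TABLE POLYDISC** (E128 §D's binders VERBATIM, `Pot := ℓ^∞(A;ℂ)`):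
`‖E_{w(Q)}(𝒞) − E_{w(Q′)}(𝒞)‖ ≤ a(γ)e^{−δ}·R₀∕(R₀² − s₀²)·‖Q − Q′‖` for `‖Q‖, ‖Q′‖ ≤ s₀ < R₀`.  E128 §C's scalarised
generating function is run as a function of the TABLE: each activity is Gâteaux-holomorphic (`LineHolo`) and bounded by its
majorant on the ball, hence Fréchet-holomorphic (`GateauxHolomorphicBall`); KP at every point of the ball gives zero-freeness
(`differentiableOn_polymerLogZ_param` over `Pot`) and the bound `a(γ)`; §1 replaces Cauchy on the stadium. [folklore] -/
theorem norm_clusterSum_sub_le_of_ballKPG_SP [Std.Refl inc] [Std.Symm inc] {w : lp (fun _ : A => ℂ) ∞ → P → ℂ}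
    {m a d : P → ℝ} (ha : ∀ γ, 0 ≤ a γ) (hd : ∀ γ, 0 ≤ d γ) {L : Finset P} {s₀ R₀ : ℝ} (hsR : s₀ < R₀)
    (hhol : ∀ γ ∈ L, LineHolo (fun Q => w Q γ) R₀)
    (hmaj : ∀ Q ∈ ball (0 : lp (fun _ : A => ℂ) ∞) R₀, ∀ γ ∈ L, ‖w Q γ‖ ≤ m γ)
    (hkp : ∀ γ ∈ L, ∑ γ' ∈ L with inc γ' γ, m γ' * Real.exp (a γ' + d γ') ≤ a γ)
    {𝒞 : Finset (Finset P)} {γ : P} (hγ : γ ∈ L) (hsub : ∀ K ∈ 𝒞, K ⊆ L) (hpin : ∀ K ∈ 𝒞, KPTouches inc K γ)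
    {δ : ℝ} (hdec : ∀ K ∈ 𝒞, δ ≤ ∑ γ' ∈ K, d γ') {Q Q' : lp (fun _ : A => ℂ) ∞} (hQ : ‖Q‖ ≤ s₀) (hQ' : ‖Q'‖ ≤ s₀) :
    ‖clusterSum inc (w Q) 𝒞 - clusterSum inc (w Q') 𝒞‖ ≤
      (a γ * Real.exp (-δ)) * R₀ / (R₀ ^ 2 - s₀ ^ 2) * ‖Q - Q'‖ := by
  set U : Set (lp (fun _ : A => ℂ) ∞) := ball 0 R₀ with hU
  have hUopen : IsOpen U := isOpen_ball
  -- the scalarised generating function, as a function of the TABLE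
  obtain ⟨𝒢, h𝒢def⟩ : ∃ 𝒢 : lp (fun _ : A => ℂ) ∞ → ℂ, 𝒢 = fun Z => ∑ C ∈ L.powerset with KPTouches inc C γ,
      (Real.exp (∑ γ' ∈ C, d γ') : ℂ) * phaseOf (truncatedWeight inc (w Q) C - truncatedWeight inc (w Q') C) *
        truncatedWeight inc (w Z) C := ⟨_, rfl⟩
  -- (0) KP at every point of the ball for the activities themselves
  have hKPU : ∀ Z ∈ U, ∀ γ₀ ∈ L, ∑ γ' ∈ L with inc γ' γ₀, ‖w Z γ'‖ * Real.exp (a γ' + d γ') ≤ a γ₀ :=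
    fun Z hZ => kpd_of_norm_le (fun γ₁ hγ₁ => hmaj _ hZ γ₁ hγ₁) hkp
  -- (1) zero-freeness of all rays of all sub-volumes on the ball
  have hZ : ∀ Z ∈ U, ∀ B : Finset P, B ⊆ L → ∀ t ∈ Set.Icc (0 : ℝ) 1,
      polymerPartitionFunction inc (fun γ' => (t : ℂ) * w Z γ') B ≠ 0 := by
    intro Z hZ' B hB t ht
    have hKPz : IsKPVolume inc (w Z) a L := isKPVolume_of_kpd hd (hKPU Z hZ')
    have hKPt : IsKPVolume inc (fun γ' => (t : ℂ) * w Z γ') a L := by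
      intro γ₀ hγ₀
      refine le_trans (Finset.sum_le_sum fun γ' _ => ?_) (hKPz γ₀ hγ₀)
      unfold kpTerm
      refine mul_le_mul_of_nonneg_right ?_ (Real.exp_nonneg _)
      rw [norm_mul, Complex.norm_real, Real.norm_eq_abs, abs_of_nonneg ht.1]
      exact mul_le_of_le_one_left (norm_nonneg _) ht.2
    exact polymerPartitionFunction_ne_zero_of_kp hKPt hB
  -- (2) each activity is FRÉCHET-holomorphic on the ball (Gâteaux + bounded); hence so is `𝒢`
  have hw : ∀ γ' ∈ L, DifferentiableOn ℂ (fun Z => w Z γ') U := fun γ' hγ' =>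
    differentiableOn_of_gateaux_of_bounded (fun Q₀ _ V => (hhol γ' hγ') Q₀ V) (fun Z hZ' => hmaj Z hZ' γ' hγ')
  have h𝒢diff : DifferentiableOn ℂ 𝒢 U := by
    rw [h𝒢def]
    refine DifferentiableOn.fun_sum fun C hC => ?_
    have hCL : C ⊆ L := Finset.mem_powerset.1 (Finset.mem_filter.1 hC).1
    refine DifferentiableOn.const_mul ?_ _
    show DifferentiableOn ℂ (fun Z => truncatedWeight inc (w Z) C) U
    unfold truncatedWeight
    refine DifferentiableOn.fun_sum fun B hB => ?_
    have hBL : B ⊆ L := (Finset.mem_powerset.1 hB).trans hCL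
    refine DifferentiableOn.const_mul ?_ _
    exact differentiableOn_polymerLogZ_param (v := w) B hUopen
      (fun γ' hγ' => hw γ' (hBL hγ')) (fun Z hZ' t ht => hZ Z hZ' B hBL t ht)
  -- (3) `‖𝒢‖ ≤ a γ` on the ball
  have h𝒢le : ∀ Z ∈ U, ‖𝒢 Z‖ ≤ a γ := by
    intro Z hZ'
    rw [h𝒢def]
    calc ‖∑ C ∈ L.powerset with KPTouches inc C γ,
            (Real.exp (∑ γ' ∈ C, d γ') : ℂ) * phaseOf (truncatedWeight inc (w Q) C - truncatedWeight inc (w Q') C) *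
              truncatedWeight inc (w Z) C‖
        ≤ ∑ C ∈ L.powerset with KPTouches inc C γ,
            ‖(Real.exp (∑ γ' ∈ C, d γ') : ℂ) * phaseOf (truncatedWeight inc (w Q) C - truncatedWeight inc (w Q') C) *
              truncatedWeight inc (w Z) C‖ := norm_sum_le _ _
      _ ≤ ∑ C ∈ L.powerset with KPTouches inc C γ,
            ‖truncatedWeight inc (w Z) C‖ * Real.exp (∑ γ' ∈ C, d γ') := by
          refine Finset.sum_le_sum fun C _ => ?_
          rw [norm_mul, norm_mul, Complex.norm_real, Real.norm_of_nonneg (Real.exp_nonneg _)]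
          have h1 := norm_phaseOf_le_one (truncatedWeight inc (w Q) C - truncatedWeight inc (w Q') C)
          have he := Real.exp_nonneg (∑ γ' ∈ C, d γ')
          have hn := norm_nonneg (truncatedWeight inc (w Z) C)
          nlinarith [mul_nonneg he hn]
      _ = touchSum inc (w Z) d L γ := rfl
      _ ≤ a γ := touchSum_le_of_kp ha hd (hKPU Z hZ') hγ
  -- (4) `𝒢 Q − 𝒢 Q′` is the (real, nonnegative) pinned difference sum
  have h𝒢QQ : 𝒢 Q - 𝒢 Q' = ((touchDiffSum inc (w Q) (w Q') d L γ : ℝ) : ℂ) := by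
    rw [h𝒢def]
    beta_reduce
    rw [← Finset.sum_sub_distrib, touchDiffSum, Complex.ofReal_sum]
    refine Finset.sum_congr rfl fun C _ => ?_
    rw [← mul_sub, mul_assoc, phaseOf_mul_self, Complex.ofReal_mul, mul_comm]
  -- (5) §1 on the table polydisc
  have h := norm_sub_le_of_polydiscSP hsR h𝒢diff h𝒢le hQ hQ'
  rw [h𝒢QQ, Complex.norm_real, Real.norm_of_nonneg (touchDiffSum_nonneg _ _ d L γ)] at h
  -- (6) localisation and the cluster sum
  have hloc := sum_norm_truncatedWeight_sub_le_touchDiffSum (inc := inc) (wA := w Q) (wB := w Q') d hsub hpin hdec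
  calc ‖clusterSum inc (w Q) 𝒞 - clusterSum inc (w Q') 𝒞‖
      ≤ ∑ K ∈ 𝒞, ‖truncatedWeight inc (w Q) K - truncatedWeight inc (w Q') K‖ := by
        unfold clusterSum
        rw [← Finset.sum_sub_distrib]
        exact norm_sum_le _ _
    _ ≤ touchDiffSum inc (w Q) (w Q') d L γ * Real.exp (-δ) := hloc
    _ ≤ (a γ * R₀ / (R₀ ^ 2 - s₀ ^ 2) * ‖Q - Q'‖) * Real.exp (-δ) :=
        mul_le_mul_of_nonneg_right h (Real.exp_nonneg _)
    _ = (a γ * Real.exp (-δ)) * R₀ / (R₀ ^ 2 - s₀ ^ 2) * ‖Q - Q'‖ := by ring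

/-- The ratio to the stadium constant: `M·R₀∕(R₀² − s₀²) = (M∕(R₀ − s₀))·(R₀∕(R₀ + s₀))`. [folklore] -/
theorem spConstant_eq_stadium_mul_ratio (M R₀ s₀ : ℝ) :
    M * R₀ / (R₀ ^ 2 - s₀ ^ 2) = M / (R₀ - s₀) * (R₀ / (R₀ + s₀)) := by
  have h3 : R₀ ^ 2 - s₀ ^ 2 = (R₀ - s₀) * (R₀ + s₀) := by ring
  rw [h3, div_mul_div_comm]

end ClusterSum

end Summit.QuantumFields.BalabanUV.T4Continuum.NE9TablePolydiscSP

end
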